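import Literature.AlgebraicGeometry.Motives.MorphismsToProjectiveSpaceBaseChange
import Literature.AlgebraicGeometry.Motives.GeneratingSectionsComap
import Literature.AlgebraicGeometry.Morphisms.AffineFpqcDescent
import HarnessLib

/-!
# «The morphism to `ℙⁿ` defined by generating sections is a closed immersion» is invariant under base change of the ring

Topic `Literature/AlgebraicGeometry/Motives`; theorems only (no definition, no named fact, no instance, no notation, no `sorry`;
one `attribute [local instance] MvPolynomial.gradedAlgebra`, Mathlib's own idiom, as in ★ `MorphismsToProjectiveSpace`).
Cell hodgecm-mathlib, F-6 functor side, LEFSCHETZ (B4) §1 = (B4a) (B-plan1 (g16) 07:58:04Z; census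
`B-provers/B-p16/g15/CENSUS-L1-Lefschetz3ThetaVeryAmple.B-p16g15.md`): the UP/DOWN transport of «`toProj` is a closed immersion»
along a ring map `k → L`, used by (B4) `AbelianVarieties/LefschetzThreeThetaVeryAmple` to move Lefschetz's theorem from `ℂ` down to a
finitely generated field and up to any field of characteristic `0`.  HC_CM is proved only modulo the 7 printed citations until
rung 0 closes; nothing here is about HC.

For `f : Y → Spec k`, generating sections `D : GeneratingSections (Fin (n+1)) Y` (★ `Motives/MorphismsToProjectiveSpace`), a `k`-algebra
`L` and a cartesian square `h : T = Y ×_k Spec L → Y` (`IsPullback h f′ f Spec(k → L)`):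

* **`isPullback_toProj_comap`** — the square `T → Y` over `ℙⁿ_L → ℙⁿ_k` formed by `(D.comap h).toProj f′` and `D.toProj f` is
  CARTESIAN (★ `comap_toProj` + ★ `toProj_comp_SpecMap_algebraMap` + ★ `ProjBaseChangeRing.isPullback_projMap′`, `IsPullback.of_bot`);
* `surjective_flat_quasiCompact_projMap` — `ℙⁿ_L → ℙⁿ_k` is surjective, flat and quasi-compact when `Spec L → Spec k` is;
* **`isClosedImmersion_toProj_comap`** (UP, Mathlib base change) and **`isClosedImmersion_toProj_of_comap`** (DOWN, along a
  surjective flat `Spec L → Spec k`, e.g. a field extension; fpqc descent of closed immersions along `ℙⁿ_L → ℙⁿ_k`, ★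
  `Morphisms/AffineFpqcDescent.isClosedImmersion_descendsAlong`, Stacks 02L6); `isClosedImmersion_toProj_comap_iff`.

## References
* R. Hartshorne, *Algebraic Geometry*, GTM 52 (1977), II Thm. 7.1 (b) (uniqueness of the morphism to `ℙⁿ`). [Hartshorne1977]
* U. Görtz, T. Wedhorn, *Algebraic Geometry I: Schemes*, 2nd ed. (2020), Remark 13.27, (13.7.1) (pp. 382–384); Prop. 14.53. [GortzWedhorn2020]
* The Stacks Project, Tag 02L6 (closed immersions descend along fpqc covers). [StacksProject]
-/

noncomputable section

set_option backward.isDefEq.respectTransparency false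

open CategoryTheory CategoryTheory.Limits AlgebraicGeometry
open MvPolynomial (X C)
open Literature.AlgebraicGeometry.Motives.Segre

universe u

attribute [local instance] MvPolynomial.gradedAlgebra

namespace Literature.AlgebraicGeometry.Motives

namespace GeneratingSections

variable {n : ℕ} {k L : Type u} [CommRing k] [CommRing L] [Algebra k L] {Y T : Scheme.{u}}
  (D : GeneratingSections (Fin (n + 1)) Y) (f : Y ⟶ Spec (.of k)) (f' : T ⟶ Spec (.of L)) (h : T ⟶ Y)
  (H : IsPullback h f' f (Spec.map (CommRingCat.ofHom (algebraMap k L))))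

include H in
/-- **The morphisms to `ℙⁿ` before and after base change form a CARTESIAN square**: for `T = Y ×_k Spec L` with projection
`h`, the `L`-morphism of the pulled-back sections `(D.comap h).toProj f′ : T → ℙⁿ_L`, the `k`-morphism `D.toProj f : Y → ℙⁿ_k` and the
base-change map `ℙⁿ_L → ℙⁿ_k` satisfy `IsPullback h ((D.comap h).toProj f′) (D.toProj f) (ℙⁿ_L → ℙⁿ_k)` (both composites to `Spec k`
agree with the given cartesian square, and `ℙⁿ_L = ℙⁿ_k ×_k Spec L`). [cite: Hartshorne1977, II Thm. 7.1 (b)]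
[cite: GortzWedhorn2020, Remark 13.27, (13.7.1) (pp. 382–384)] -/
theorem isPullback_toProj_comap :
    IsPullback h ((D.comap h).toProj f') (D.toProj f)
      (Proj.map (ProjBaseChangeRing.mapGraded k L (Fin (n + 1))) (ProjBaseChangeRing.irrelevant_le_map k L (Fin (n + 1)))) := by
  have hsq : h ≫ D.toProj f = (D.comap h).toProj f' ≫
      Proj.map (ProjBaseChangeRing.mapGraded k L (Fin (n + 1))) (ProjBaseChangeRing.irrelevant_le_map k L (Fin (n + 1))) := by
    rw [← toProj_comp_SpecMap_algebraMap, ← H.w, comap_toProj]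
  refine IsPullback.of_bot ?_ hsq (ProjBaseChangeRing.isPullback_projMap' k L (n := n))
  have e1 : D.toProj f ≫ ProjBaseChangeRing.projToSpec (Fin (n + 1)) k = f := toProj_toSpec D f
  have e2 : (D.comap h).toProj f' ≫ ProjBaseChangeRing.projToSpec (Fin (n + 1)) L = f' := toProj_toSpec _ f'
  rw [e1, e2]
  exact H

/-- **`ℙⁿ_L → ℙⁿ_k` is surjective, flat and quasi-compact** when `Spec L → Spec k` is (base change, ★ `isPullback_projMap′`).
[cite: GortzWedhorn2020, Remark 13.27, (13.7.1) (pp. 382–384)] -/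
theorem surjective_flat_quasiCompact_projMap [Surjective (Spec.map (CommRingCat.ofHom (algebraMap k L)))]
    [Flat (Spec.map (CommRingCat.ofHom (algebraMap k L)))] :
    Surjective (Proj.map (ProjBaseChangeRing.mapGraded k L (Fin (n + 1))) (ProjBaseChangeRing.irrelevant_le_map k L (Fin (n + 1)))) ∧
    Flat (Proj.map (ProjBaseChangeRing.mapGraded k L (Fin (n + 1))) (ProjBaseChangeRing.irrelevant_le_map k L (Fin (n + 1)))) ∧
    QuasiCompact (Proj.map (ProjBaseChangeRing.mapGraded k L (Fin (n + 1))) (ProjBaseChangeRing.irrelevant_le_map k L (Fin (n + 1)))) :=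
  have hP := ProjBaseChangeRing.isPullback_projMap' k L (n := n)
  ⟨MorphismProperty.of_isPullback hP.flip ‹_›, MorphismProperty.of_isPullback hP.flip ‹_›,
    MorphismProperty.of_isPullback hP.flip inferInstance⟩

include H in
/-- **UP**: if `D.toProj f : Y → ℙⁿ_k` is a closed immersion, so is the morphism of the pulled-back sections
`(D.comap h).toProj f′ : T → ℙⁿ_L` (closed immersions are stable under base change).
[cite: Hartshorne1977, II Thm. 7.1 (b)] [cite: GortzWedhorn2020, Remark 13.27, (13.7.1) (pp. 382–384)] -/
theorem isClosedImmersion_toProj_comap [IsClosedImmersion (D.toProj f)] : IsClosedImmersion ((D.comap h).toProj f') :=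
  MorphismProperty.of_isPullback (D.isPullback_toProj_comap f f' h H) ‹_›

include H in
/-- **DOWN (fpqc descent)**: if `Spec L → Spec k` is surjective and flat (e.g. a field extension), then `(D.comap h).toProj f′` a
closed immersion implies `D.toProj f` a closed immersion: closed immersions descend along the surjective flat quasi-compact
`ℙⁿ_L → ℙⁿ_k` (★ `isClosedImmersion_descendsAlong`, Stacks 02L6). [cite: StacksProject, Tag 02L6] [cite: GortzWedhorn2020, Prop. 14.53] -/
theorem isClosedImmersion_toProj_of_comap
    [Surjective (Spec.map (CommRingCat.ofHom (algebraMap k L)))] [Flat (Spec.map (CommRingCat.ofHom (algebraMap k L)))]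
    [IsClosedImmersion ((D.comap h).toProj f')] : IsClosedImmersion (D.toProj f) :=
  haveI := Literature.AlgebraicGeometry.Morphisms.isClosedImmersion_descendsAlong.{u}
  have hQ := surjective_flat_quasiCompact_projMap (n := n) (k := k) (L := L)
  MorphismProperty.of_isPullback_of_descendsAlong (P := @IsClosedImmersion)
    (Q := @Surjective ⊓ @Flat ⊓ @QuasiCompact) (D.isPullback_toProj_comap f f' h H).flip ⟨⟨hQ.1, hQ.2.1⟩, hQ.2.2⟩ ‹_›

include H in
/-- UP and DOWN together. [cite: StacksProject, Tag 02L6] [cite: Hartshorne1977, II Thm. 7.1 (b)] -/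
theorem isClosedImmersion_toProj_comap_iff
    [Surjective (Spec.map (CommRingCat.ofHom (algebraMap k L)))] [Flat (Spec.map (CommRingCat.ofHom (algebraMap k L)))] :
    IsClosedImmersion ((D.comap h).toProj f') ↔ IsClosedImmersion (D.toProj f) :=
  ⟨fun _ => D.isClosedImmersion_toProj_of_comap f f' h H, fun _ => D.isClosedImmersion_toProj_comap f f' h H⟩

end GeneratingSections

end Literature.AlgebraicGeometry.Motives

end
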